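import Literature.Probability.LatticeModels.IsingModel
import HarnessLib

/-!
# Monotonicity of the first Lee–Yang zero in the couplings (Camia–Jiang–Newman 2023, Theorem 2)

Topic `Literature/Probability/LatticeModels`; family `crit-ising`. NAMED FACT (D-0014), no sorry.
Requested (in substance) by route `CriticalPhenomena/Ising3DConformalLimit/LeeYangGap`: its support
item `Summit.CriticalPhenomena.Ising3DConformalLimit.Theses.LeeYangGap.FirstZeroAntitoneInBeta`
(stmt-CriticalPhenomena-4947) is the instance `G = zdGraph 3`, `Λ = box 3 M`, `B = box 3 L`,
`λ ≡ 1` of the fact below (up to `one_mul`); its glue item `MonotonicityTransfer` (4948) passes it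
to the infinite-volume state.

## Source (READ this session: arXiv:2207.12247 = CMP (2023), doi:10.1007/s00220-023-04693-x, §1)

F. Camia, J. Jiang, C. M. Newman, *Monotonicity of Ursell functions in the Ising model*
[CamiaJiangNewman2023]. Setting (§1.1–1.2): finite graph `G = (V,E)`, ferromagnetic pair
interactions `𝐉 = (J_{uv})`, Gibbs weight `exp[∑_{uv ∈ E} J_{uv} σ_u σ_v]` at zero field
(`⟨·⟩_{G,𝐉}`), and for nonnegative weights `λ = (λ_u)_{u ∈ V}` the moment generating function
`h ↦ ⟨exp[h ∑_{u} λ_u σ_u]⟩_{G,𝐉}`, `h ∈ ℂ`, all of whose zeros are purely imaginary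
("A generalization of the Lee–Yang result (see, e.g., Theorem 1 of [New75] or Lemma 4.2 of
[NG83])", proof of Thm. 2, p. 4), written `± i α_j`, `0 < α₁ ≤ α₂ ≤ …`.

* **Theorem 1** (monotonicity of Ursell functions): `(-1)^{k-1} ∂u_{2k}(σ_{j_1},…,σ_{j_{2k}})/∂J_{u₀v₀} ≥ 0`.
* **Theorem 2** (the Nishimori–Griffiths conjecture): "Let `G = (V,E)` be a finite graph, `𝐉` and
  `𝐉̃` be ferromagnetic pair interactions on `G` satisfying `0 ≤ J_{uv} ≤ J̃_{uv}` for each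
  `uv ∈ E`. Suppose that `{λ_u}_{u ∈ V}` is a collection of nonnegative real numbers. Let `α₁(𝐉)`
  (resp., `α₁(𝐉̃)`) be the modulus of the first zero of `⟨exp[h∑_{u∈V} λ_uσ_u]⟩_{G,𝐉}` (resp.,
  `⟨exp[h∑_{u∈V} λ_uσ_u]⟩_{G,𝐉̃}`). Then we have `α₁(𝐉) ≥ α₁(𝐉̃)`."
* **Corollary 1**: the same for the partition function `Z_{G,𝐉,h}` (`λ ≡ 1`).

## Transcription

The tree's finite-volume nearest-neighbour Gibbs expectation `isingExpect G Λ β 0 .free` on a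
finite volume `Λ` of a locally finite graph `G` with FREE boundary condition and zero field is the
source's `⟨·⟩_{G_Λ,𝐉}` for the finite graph `G_Λ = (Λ, edges inside Λ)` with the homogeneous
coupling `J_{uv} = β` (Friedli–Velenik normalisation `exp[β ∑_{uv} σ_uσ_v]`); two inverse
temperatures `0 ≤ β ≤ β'` give `𝐉 ≤ 𝐉̃` edgewise. With `X = ∑_{u ∈ B} λ_u σ_u` (`B ⊆ Λ`,
`λ ≥ 0` on `B`; weights outside `B` set to `0`), the law of `X` under the zero-field measure is
symmetric, so `⟨e^{iθX}⟩ = ⟨cos(θX)⟩` for real `θ`, and — all zeros of `h ↦ ⟨e^{hX}⟩` being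
purely imaginary — the positive real zeros `θ` of `θ ↦ ⟨cos(θX)⟩` are exactly the moduli `α_j`.
"`α₁(𝐉) ≥ α₁(𝐉̃)`" is rendered without naming the first zero: EVERY positive real zero `θ` of
`⟨cos(θX)⟩_β` bounds from above SOME positive real zero `θ'` of `⟨cos(θ'X)⟩_{β'}` (take
`θ' = α₁(𝐉̃) ≤ α₁(𝐉) ≤ θ`; if `X ≡ 0` on `B` there is no zero at all and the statement is
vacuous, otherwise the first zero at `β'` exists: a non-constant finite exponential sum has zeros,
and `α₁ > 0` because the value at `h = 0` is `1`). This is the form consumed by the route items.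
Named fact (the printed proof uses Theorem 1 via `d α₁/dJ ≤ 0` from `α₁^{-2k}`-asymptotics of
`u_{2k}(X)`, eqs. (12)–(14)); users take `(h : CamiaJiangNewman.firstZero_antitone)`.

References: [CamiaJiangNewman2023] Thm. 2, Cor. 1 (arXiv:2207.12247 §1.2, pp. 3–4);
[Newman1975] C. M. Newman, CMP 41 (1975) 1–9, Thm. 1 (pure imaginary zeros with weights);
[JiangNewman2023] (application: thermodynamic limit of the first zero, tree file
`LeeYangFirstZeroLimit.lean`); Nishimori–Griffiths, J. Math. Phys. 24 (1983) 2637 (the conjecture).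
-/

noncomputable section

namespace Literature.Probability.LatticeModels

namespace CamiaJiangNewman

/-- NAMED FACT — **Camia–Jiang–Newman 2023, Theorem 2 (monotonicity of the first Lee–Yang zero in
the couplings), for the homogeneous nearest-neighbour coupling at two inverse temperatures
`0 ≤ β ≤ β'`, free boundary condition, zero field, nonnegative weights `λ` on a block `B ⊆ Λ`.**
Printed: "Let `G = (V,E)` be a finite graph, `𝐉` and `𝐉̃` be ferromagnetic pair interactions on
`G` satisfying `0 ≤ J_{uv} ≤ J̃_{uv}` for each `uv ∈ E`. Suppose that `{λ_u}_{u∈V}` is a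
collection of nonnegative real numbers. Let `α₁(𝐉)` (resp., `α₁(𝐉̃)`) be the modulus of the first
zero of `⟨exp[h∑λ_uσ_u]⟩_{G,𝐉}` (resp., `…_{G,𝐉̃}`). Then we have `α₁(𝐉) ≥ α₁(𝐉̃)`."
Rendered (see the file header for the dictionary real zeros of `⟨cos θX⟩` = moduli of the purely
imaginary zeros of `⟨e^{hX}⟩`): if `θ > 0` is a zero of `θ ↦ ⟨cos(θ ∑_{u∈B} λ_uσ_u)⟩^{free}_{Λ;β,0}`
then `⟨cos(θ' ∑_{u∈B} λ_uσ_u)⟩^{free}_{Λ;β',0} = 0` for some `0 < θ' ≤ θ`.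
[cite: CamiaJiangNewman2023, Theorem 2 and Corollary 1 (arXiv:2207.12247 §1.2)] -/
def firstZero_antitone : Prop :=
  ∀ {V : Type} [DecidableEq V] (G : SimpleGraph V) [G.LocallyFinite] (Λ B : Finset V),
    B ⊆ Λ → ∀ (lam : V → ℝ), (∀ u ∈ B, 0 ≤ lam u) →
      ∀ (β β' θ : ℝ), 0 ≤ β → β ≤ β' → 0 < θ →
        isingExpect G Λ β 0 .free (fun σ => Real.cos (θ * ∑ u ∈ B, lam u * spinAt u σ)) = 0 →
          ∃ θ' : ℝ, 0 < θ' ∧ θ' ≤ θ ∧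
            isingExpect G Λ β' 0 .free (fun σ => Real.cos (θ' * ∑ u ∈ B, lam u * spinAt u σ)) = 0

end CamiaJiangNewman

end Literature.Probability.LatticeModels
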